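import Summits.Ventures.PercRepro.S1CoreCapSevenTwo

/-!
# PercRepro — TOWARDS `Q*(8)`: TWO BIG LINES IN A PLANE (p1, gen 27)

The `ν = 8` reading of `S1CoreCapSevenTwo`: two lines `L₁, L₂` of `≥ 4` points lying in a common
duplicate-free list of `lineRank ≤ 3`. The plane on them has `c ≤ 9` points (`h5`), `u = |L₁ ∪ L₂|` of them on
the big lines, the other lines of the plane are CHORDS through one of the `c − u ≤ 2` HUBS, at most
`(c − 1)/2` through one hub and `(c − 2)/2` through the second avoiding the first (`Seven.card_chords_le`); a fat
point of the plane lies on at most `(c − 1)/2` of its lines (`Seven.sum_fat_plane_le₃`); the cost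
`c + f₀ − 3 ≤ 8` leaves the thin family outside the budget `11 − c − f₀`. The table over
`(|L₁|, |L₂|, u, c, f₀)` reads at most `23` — `sum_cap_le_twenty_three_of_two_big_plane` — with equality at
`c = 9, u = 7, f₀ = 2`: two 4-point lines through a vertex, two hubs, seven chords, both hubs fat
(`8 + 7 + 4 + 4`), the configuration of the searches' witness at `ν = 7` with its second hub made fat.
`proofs/P1-S4-CAPBRIDGE.md` §19. Axioms: standard.
-/

namespace PercRepro

namespace S1

namespace FourCap

namespace Eight

open Seven

variable {β : Type} [DecidableEq β]

section TwoBig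

variable {w : β → ℕ} {ls : Finset (Finset β)}
  (h1 : ∀ L ∈ ls, ∀ v ∈ L, w v = 1 ∨ w v = 2)
  (h2 : ∀ L ∈ ls, 3 ≤ L.card ∧ wsum w L ≤ 5)
  (h3 : ∀ L ∈ ls, ∀ L' ∈ ls, L ≠ L' → (L ∩ L').card ≤ 1)
  (h4 : ∀ l : List (Finset β), l.Nodup → (∀ L ∈ l, L ∈ ls) → wsum w (unionL l) ≤ 8 + lineRank l)
  (h5 : ∀ l : List (Finset β), l.Nodup → (∀ L ∈ l, L ∈ ls) → lineRank l ≤ 3 → (unionL l).card ≤ 9)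
  {L₁ L₂ : Finset β} (hL₁ : L₁ ∈ ls) (hL₂ : L₂ ∈ ls) (h12 : L₂ ≠ L₁)
  (c1 : 4 ≤ L₁.card) (c2 : 4 ≤ L₂.card)
  (hrest : ∀ L ∈ ls, L ≠ L₁ → L ≠ L₂ → L.card = 3)

include h1 h2 h3 h4 h5 hL₁ hL₂ h12 c1 c2 hrest in
/-- **Two big lines in a plane at nullity `8`: cap sum `≤ 23`** — given a duplicate-free list `l₀` of lines of
`ls` with `lineRank l₀ ≤ 3` containing `L₁` and `L₂`. -/
theorem sum_cap_le_twenty_three_of_two_big_plane {l₀ : List (Finset β)} (hnd₀ : l₀.Nodup)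
    (hls₀ : ∀ L ∈ l₀, L ∈ ls) (hr₀ : lineRank l₀ ≤ 3) (hl₁ : L₁ ∈ l₀) (hl₂ : L₂ ∈ l₀) :
    ∑ L ∈ ls, capPaper L.card (fat w L) ≤ 23 := by
  have h2' := two_le_card_of_spec₇ h2
  obtain ⟨l, hnd, hls, hr, hsub, hmax⟩ := exists_plane ls _ l₀ le_rfl hnd₀ hls₀ hr₀
  have hc9 : (unionL l).card ≤ 9 := card_plane_le_nine h5 hnd hls hr
  have hL₁l : L₁ ∈ l := hsub L₁ hl₁
  have hL₂l : L₂ ∈ l := hsub L₂ hl₂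
  have hU : L₁ ∪ L₂ ⊆ unionL l := by
    intro v hv
    rcases Finset.mem_union.1 hv with h | h
    · exact mem_unionL_iff.2 ⟨L₁, hL₁l, h⟩
    · exact mem_unionL_iff.2 ⟨L₂, hL₂l, h⟩
  have hu := Finset.card_union_add_card_inter L₁ L₂
  have p12 := h3 L₁ hL₁ L₂ hL₂ h12.symm
  have hcU := Finset.card_le_card hU
  have hHc := Finset.card_sdiff_add_card_eq_card hU
  -- the cost of the plane: `c + f₀ ≤ 11`
  have hcs := wsum_unionL_eq w l (fun L hL => h1 L (hls L hL)) (fun L hL => h2' L (hls L hL))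
  rw [wsum_eq_card_add_fat w (unionL l) (fun v hv => by
    obtain ⟨L, hL, hvL⟩ := mem_unionL_iff.1 hv
    exact h1 L (hls L hL) v hvL)] at hcs
  have hcost : (unionL l).card + fat w (unionL l) ≤ 11 := by
    have hb := costSum_le h1 h2' h4 l hnd hls
    omega
  -- the fat points of the plane
  have hfatin := sum_fat_plane_le₃ w l (fun L hL => (h2 L (hls L hL)).1)
    (fun L hL L' hL' hne => h3 L (hls L hL) L' (hls L' hL') hne)
  -- the chords
  set S := (l.toFinset.erase L₁).erase L₂ with hS
  have hSmem : ∀ X ∈ S, X ∈ l ∧ X ≠ L₁ ∧ X ≠ L₂ := fun X hX => by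
    have h2'' := Finset.mem_erase.1 hX
    have h1' := Finset.mem_erase.1 h2''.2
    exact ⟨List.mem_toFinset.1 h1'.2, h1'.1, h2''.1⟩
  have hchords := card_chords_le (L₁ := L₁) (L₂ := L₂) S (fun X hX => by
    obtain ⟨hXl, hX1, hX2⟩ := hSmem X hX
    exact ⟨hrest X (hls X hXl) hX1 hX2, fun v hv => mem_unionL_iff.2 ⟨X, hXl, hv⟩,
      h3 X (hls X hXl) L₁ hL₁ hX1, h3 X (hls X hXl) L₂ hL₂ hX2⟩)
    (fun X hX X' hX' hne => h3 X (hls X (hSmem X hX).1) X' (hls X' (hSmem X' hX').1) hne)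
  -- the thin family outside
  set T := ls.filter (fun L => L ∉ l) with hT
  have hTmem : ∀ L ∈ T, L ∈ ls ∧ L ∉ l := fun L hL => Finset.mem_filter.1 hL
  have hT3 : ∀ L ∈ T, L.card = 3 := fun L hL => hrest L (hTmem L hL).1
    (fun h => (hTmem L hL).2 (h ▸ hL₁l)) (fun h => (hTmem L hL).2 (h ▸ hL₂l))
  have hk : ∀ t : List (Finset β), t.Nodup → (∀ L ∈ t, L ∈ T) →
      freeCountR (unionL l) t + fat w (unionLR (unionL l) t \ unionL l) ≤
        11 - (unionL l).card - fat w (unionL l) := by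
    intro t hndt hlt
    have hb := budget_of_prefix h1 h2' h4 l t (by
      rw [List.nodup_append']
      exact ⟨hndt, hnd, fun L hLt hLl => (hTmem L (hlt L hLt)).2 hLl⟩)
      (fun L hL => by
        rcases List.mem_append.1 hL with hL | hL
        · exact (hTmem L (hlt L hL)).1
        · exact hls L hL)
      (fun L hL => hT3 L (hlt L hL))
    have hsplit := fat_sdiff_add_fat_of_subset w (subset_unionLR (unionL l) t)
    omega
  have hthin := two_mul_sum_cap_thin_le w (unionL l) T
    (fun L hL => ⟨hT3 L hL, hmax L (hTmem L hL).1 (hTmem L hL).2⟩)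
    (fun L hL L' hL' hne => h3 L (hTmem L hL).1 L' (hTmem L' hL').1 hne)
    (fun L hL => h1 L (hTmem L hL).1) (fun L hL => (h2 L (hTmem L hL).1).2) hk
  -- the sum
  have hsplit := Finset.sum_filter_add_sum_filter_not ls (fun L => L ∈ l) (fun L => capPaper L.card (fat w L))
  have hfil : ls.filter (fun L => L ∈ l) = l.toFinset := by
    ext L
    simp only [Finset.mem_filter, List.mem_toFinset]
    exact ⟨fun h => h.2, fun h => ⟨hls L h, h⟩⟩
  rw [hfil, ← hT] at hsplit
  rw [← hsplit]
  have hL₁f : L₁ ∈ l.toFinset := List.mem_toFinset.2 hL₁l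
  have hL₂f : L₂ ∈ l.toFinset.erase L₁ := Finset.mem_erase.2 ⟨h12, List.mem_toFinset.2 hL₂l⟩
  have esum : ∀ f : Finset β → ℕ, ∑ L ∈ l.toFinset, f L = f L₁ + (f L₂ + ∑ X ∈ S, f X) := by
    intro f
    rw [← Finset.add_sum_erase _ f hL₁f, ← Finset.add_sum_erase _ f hL₂f]
  have hcap3 : ∀ X ∈ S, capPaper X.card (fat w X) = 1 + fat w X := by
    intro X hX
    obtain ⟨hXl, hX1, hX2⟩ := hSmem X hX
    have hXls := hls X hXl
    have := wsum_eq_card_add_fat w X (h1 X hXls)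
    have := (h2 X hXls).2
    have hXc := hrest X hXls hX1 hX2
    rw [hXc, capPaper_three_eq' (by omega)]
  rw [esum, capPaper_big_eq h1 h2 hL₁ c1, capPaper_big_eq h1 h2 hL₂ c2, Finset.sum_congr rfl hcap3,
    Finset.sum_add_distrib, Finset.sum_const_nat (m := 1) (fun _ _ => rfl), Nat.mul_one]
  rw [esum] at hfatin
  -- the table
  have hw1 := (h2 L₁ hL₁).2
  have hw2 := (h2 L₂ hL₂).2
  have hwa := wsum_eq_card_add_fat w L₁ (h1 L₁ hL₁)
  have hwb := wsum_eq_card_add_fat w L₂ (h1 L₂ hL₂)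
  obtain ⟨hch1, hch2⟩ := hchords
  generalize hc : (unionL l).card = c at hfatin hthin hcost hc9 hcU hHc hch1 hch2
  generalize hf : fat w (unionL l) = f₀ at hfatin hthin hcost
  generalize (unionL l \ (L₁ ∪ L₂)).card = hh at hHc hch1 hch2
  generalize (L₁ ∪ L₂).card = u at hu hcU hHc
  generalize L₁.card = k1 at c1 hw1 hwa hu ⊢
  generalize L₂.card = k2 at c2 hw2 hwb hu ⊢
  generalize (L₁ ∩ L₂).card = i at p12 hu
  generalize S.card = s at hch1 hch2 ⊢
  generalize fat w L₁ = a at hwa hfatin ⊢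
  generalize fat w L₂ = b at hwb hfatin ⊢
  generalize ∑ X ∈ S, fat w X = d at hfatin ⊢
  generalize ∑ L ∈ T, capPaper L.card (fat w L) = e at hthin ⊢
  have hk1 : k1 ≤ 5 := by omega
  have hk2 : k2 ≤ 5 := by omega
  have hf4 : f₀ ≤ 4 := by omega
  have hh2 : hh ≤ 2 := by omega
  interval_cases k1 <;> interval_cases k2 <;> interval_cases hh <;> interval_cases c <;> interval_cases f₀ <;> omega

end TwoBig

end Eight

end FourCap

end S1

end PercRepro
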